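import Summits.Ventures.Crystal3D.StickySpheres.ContactGraph
import Literature.MathematicalPhysics.StatisticalMechanics.BarlowCoordination
import Literature.Probability.LatticeModels.LatticeGraph
import HarnessLib

/-!
# The twelve contact offsets of the fcc packing; fcc has no contact bipyramid

HONEST FRAMING. Part of the venture `Summits/Ventures/Crystal3D` (cells `pub-crystal3d`,
`crystal3d-full`). Elementary lattice combinatorics; nothing here is a claim about ground states or
three-dimensional crystallization.

In the integer chart `(k, i, j) ↦ barlowPos 1 √(2/3) constHagg k i j` of the touching fcc packing
`fccStacking 1 √(2/3)`, two sites are in contact (distance `1`) iff the distance form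
`3(2P+Q+K)² + (3Q+K)² + 8K²` of their difference `(K, P, Q)` equals `12`
(`BarlowCoordination.dist_barlowPos_eq_iff_form`, `haggLabel_const`), iff `(K, P, Q)` is one of the
TWELVE OFFSETS `±(1,0,0), ±(0,1,0), ±(0,0,1), ±(1,−1,0), ±(1,0,−1), ±(0,1,−1)`
(`mem_fccOffsets_of_form_eq_twelve`; the cuboctahedral shell in coordinates).

* `fccOffsets_commonNeighbor_unique` — two touching offsets have at most ONE common touching
  offset (a `decide` over the twelve): a unit triangle of the fcc packing has exactly one apex.
* `fcc_noBipyramid` — **eng COROLLARY 1 of the cell `crystal3d-full`** (HOME/eng/LEMMAS-b-bracket.md;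
  typed as `FccNoBipyramid` in HOME/cf-p1/lean/WulffSelection.lean, ROUTE.md §11.4/§16): in the fcc
  packing two contact tetrahedra never share a face — if `p` and `q` both touch all three vertices
  of a contact triangle `a, b, c`, then `p = q`.  (Geometrically: the mirror image of the apex in
  the face is the octahedral-hole direction `a + b + c − 2p`-type point at squared distance `8/3`,
  not a lattice contact; here it is read off the finite offset table.)  Consequence used by the
  cell: a Barlow packing contains no contact bipyramid whose axis differs from its stacking axis,
  so the fcc host's clusters have bipyramid count `b = 0` along every foreign axis.

WHAT THIS IS NOT: not a statement about hcp or general Barlow stackings (which DO contain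
face-sharing tetrahedra across every `h`-layer); not about off-lattice packings.
-/

noncomputable section

namespace Summit.Ventures.Crystal3D

open Finset
open Literature.Probability.LatticeModels (Site)
open Literature.MathematicalPhysics.StatisticalMechanics (barlowPos barlowStacking fccStacking
  constHagg haggLabel_const dist_barlowPos_eq_iff_form)

/-- **The shell equation has twelve solutions.** If the fcc distance form of `(K, P, Q)` equals
`12`, then `(K, P, Q)` is one of the twelve contact offsets. -/
theorem mem_fccOffsets_of_form_eq_twelve (K P Q : ℤ)
    (h : 3 * (2 * P + Q + K) ^ 2 + (3 * Q + K) ^ 2 + 8 * K ^ 2 = 12) :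
    (![K, P, Q] : Site 3) ∈ ({![1, 0, 0], ![-1, 0, 0], ![0, 1, 0], ![0, -1, 0], ![0, 0, 1],
      ![0, 0, -1], ![1, -1, 0], ![-1, 1, 0], ![1, 0, -1], ![-1, 0, 1], ![0, 1, -1],
      ![0, -1, 1]} : Finset (Site 3)) := by
  have hK2 : K ^ 2 ≤ 1 := by nlinarith [sq_nonneg (2 * P + Q + K), sq_nonneg (3 * Q + K)]
  have hQ2 : (3 * Q + K) ^ 2 ≤ 12 := by nlinarith [sq_nonneg (2 * P + Q + K), sq_nonneg K]
  have hP2 : 3 * (2 * P + Q + K) ^ 2 ≤ 12 := by nlinarith [sq_nonneg (3 * Q + K), sq_nonneg K]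
  have hK : -1 ≤ K ∧ K ≤ 1 := by constructor <;> nlinarith
  have hQK : -3 ≤ 3 * Q + K ∧ 3 * Q + K ≤ 3 := by constructor <;> nlinarith
  have hPQK : -2 ≤ 2 * P + Q + K ∧ 2 * P + Q + K ≤ 2 := by constructor <;> nlinarith
  have hQ : -1 ≤ Q ∧ Q ≤ 1 := by omega
  have hP : -2 ≤ P ∧ P ≤ 2 := by omega
  obtain ⟨hK1, hK2'⟩ := hK
  obtain ⟨hQ1, hQ2'⟩ := hQ
  obtain ⟨hP1, hP2'⟩ := hP
  interval_cases K <;> interval_cases P <;> interval_cases Q <;> first | decide | (norm_num at h)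

/-- **Common touching neighbours are unique.** Among the twelve fcc contact offsets, if `b` and
`c` touch (`c − b` is an offset) then at most one offset `p` touches both (`p − b`, `p − c`
offsets): every contact triangle `0, b, c` of the fcc packing has exactly one apex. (`decide`.) -/
theorem fccOffsets_commonNeighbor_unique :
    ∀ b ∈ ({![1, 0, 0], ![-1, 0, 0], ![0, 1, 0], ![0, -1, 0], ![0, 0, 1],
      ![0, 0, -1], ![1, -1, 0], ![-1, 1, 0], ![1, 0, -1], ![-1, 0, 1], ![0, 1, -1],
      ![0, -1, 1]} : Finset (Site 3)),
    ∀ c ∈ ({![1, 0, 0], ![-1, 0, 0], ![0, 1, 0], ![0, -1, 0], ![0, 0, 1],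
      ![0, 0, -1], ![1, -1, 0], ![-1, 1, 0], ![1, 0, -1], ![-1, 0, 1], ![0, 1, -1],
      ![0, -1, 1]} : Finset (Site 3)),
    c - b ∈ ({![1, 0, 0], ![-1, 0, 0], ![0, 1, 0], ![0, -1, 0], ![0, 0, 1],
      ![0, 0, -1], ![1, -1, 0], ![-1, 1, 0], ![1, 0, -1], ![-1, 0, 1], ![0, 1, -1],
      ![0, -1, 1]} : Finset (Site 3)) →
    ∀ p ∈ ({![1, 0, 0], ![-1, 0, 0], ![0, 1, 0], ![0, -1, 0], ![0, 0, 1],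
      ![0, 0, -1], ![1, -1, 0], ![-1, 1, 0], ![1, 0, -1], ![-1, 0, 1], ![0, 1, -1],
      ![0, -1, 1]} : Finset (Site 3)),
    p - b ∈ ({![1, 0, 0], ![-1, 0, 0], ![0, 1, 0], ![0, -1, 0], ![0, 0, 1],
      ![0, 0, -1], ![1, -1, 0], ![-1, 1, 0], ![1, 0, -1], ![-1, 0, 1], ![0, 1, -1],
      ![0, -1, 1]} : Finset (Site 3)) →
    p - c ∈ ({![1, 0, 0], ![-1, 0, 0], ![0, 1, 0], ![0, -1, 0], ![0, 0, 1],
      ![0, 0, -1], ![1, -1, 0], ![-1, 1, 0], ![1, 0, -1], ![-1, 0, 1], ![0, 1, -1],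
      ![0, -1, 1]} : Finset (Site 3)) →
    ∀ q ∈ ({![1, 0, 0], ![-1, 0, 0], ![0, 1, 0], ![0, -1, 0], ![0, 0, 1],
      ![0, 0, -1], ![1, -1, 0], ![-1, 1, 0], ![1, 0, -1], ![-1, 0, 1], ![0, 1, -1],
      ![0, -1, 1]} : Finset (Site 3)),
    q - b ∈ ({![1, 0, 0], ![-1, 0, 0], ![0, 1, 0], ![0, -1, 0], ![0, 0, 1],
      ![0, 0, -1], ![1, -1, 0], ![-1, 1, 0], ![1, 0, -1], ![-1, 0, 1], ![0, 1, -1],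
      ![0, -1, 1]} : Finset (Site 3)) →
    q - c ∈ ({![1, 0, 0], ![-1, 0, 0], ![0, 1, 0], ![0, -1, 0], ![0, 0, 1],
      ![0, 0, -1], ![1, -1, 0], ![-1, 1, 0], ![1, 0, -1], ![-1, 0, 1], ![0, 1, -1],
      ![0, -1, 1]} : Finset (Site 3)) →
    p = q := by
  decide

/-- **fcc has no contact bipyramid** (eng Corollary 1; `FccNoBipyramid` of the cell's typed
statements): if `p` and `q` both touch the three vertices of a contact triangle `a, b, c` of the
fcc packing `fccStacking 1 √(2/3)`, then `p = q`. -/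
theorem fcc_noBipyramid :
    ∀ a ∈ fccStacking 1 (Real.sqrt (2 / 3)), ∀ b ∈ fccStacking 1 (Real.sqrt (2 / 3)),
    ∀ c ∈ fccStacking 1 (Real.sqrt (2 / 3)), ∀ p ∈ fccStacking 1 (Real.sqrt (2 / 3)),
      ∀ q ∈ fccStacking 1 (Real.sqrt (2 / 3)),
        dist a b = 1 → dist a c = 1 → dist b c = 1 →
        dist a p = 1 → dist b p = 1 → dist c p = 1 →
        dist a q = 1 → dist b q = 1 → dist c q = 1 → p = q := by
  rintro a ⟨ka, ia, ja, rfl⟩ b ⟨kb, ib, jb, rfl⟩ c ⟨kc, ic, jc, rfl⟩ p ⟨kp, ip, jp, rfl⟩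
    q ⟨kq, iq, jq, rfl⟩ hab hac hbc hap hbp hcp haq hbq hcq
  have hh : (Real.sqrt (2 / 3)) ^ 2 = 2 / 3 * (1 : ℝ) ^ 2 := by
    rw [Real.sq_sqrt (by norm_num)]; ring
  -- every contact is an offset of the table, in coordinates relative to the earlier point
  have key : ∀ k i j k' i' j' : ℤ,
      dist (barlowPos 1 (Real.sqrt (2 / 3)) constHagg k i j)
        (barlowPos 1 (Real.sqrt (2 / 3)) constHagg k' i' j') = 1 →
      (![k' - k, i' - i, j' - j] : Site 3) ∈ ({![1, 0, 0], ![-1, 0, 0], ![0, 1, 0], ![0, -1, 0],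
        ![0, 0, 1], ![0, 0, -1], ![1, -1, 0], ![-1, 1, 0], ![1, 0, -1], ![-1, 0, 1], ![0, 1, -1],
        ![0, -1, 1]} : Finset (Site 3)) := by
    intro k i j k' i' j' hd
    rw [dist_comm, dist_barlowPos_eq_iff_form one_pos hh constHagg, haggLabel_const,
      haggLabel_const] at hd
    exact mem_fccOffsets_of_form_eq_twelve _ _ _ hd
  have hsub : ∀ k i j k' i' j' : ℤ,
      (![k' - k, i' - i, j' - j] : Site 3) =
        (![k' - ka, i' - ia, j' - ja] : Site 3) - ![k - ka, i - ia, j - ja] := by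
    intro k i j k' i' j'
    ext l
    fin_cases l <;> simp [sub_sub_sub_cancel_right]
  have h := fccOffsets_commonNeighbor_unique _ (key _ _ _ _ _ _ hab) _ (key _ _ _ _ _ _ hac)
    (by rw [← hsub]; exact key _ _ _ _ _ _ hbc) _ (key _ _ _ _ _ _ hap)
    (by rw [← hsub]; exact key _ _ _ _ _ _ hbp) (by rw [← hsub]; exact key _ _ _ _ _ _ hcp)
    _ (key _ _ _ _ _ _ haq) (by rw [← hsub]; exact key _ _ _ _ _ _ hbq)
    (by rw [← hsub]; exact key _ _ _ _ _ _ hcq)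
  have h0 := congrFun h 0
  have h1 := congrFun h 1
  have h2 := congrFun h 2
  simp only [Matrix.cons_val_zero, Matrix.cons_val_one, Matrix.cons_val] at h0 h1 h2
  have ek : kp = kq := by omega
  have ei : ip = iq := by omega
  have ej : jp = jq := by omega
  rw [ek, ei, ej]

end Summit.Ventures.Crystal3D

end
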